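import Literature.Probability.Percolation.QuadCrossingGluingSteps
import Literature.Probability.Percolation.QuadCrossingCutCovering
import Literature.Probability.Percolation.QuadCrossingRawClosed
import Literature.Probability.Percolation.QuadCrossingQuadTopology
import Literature.Probability.Percolation.QuadCrossingContinuityReduction
import Literature.Probability.Percolation.AnnulusCrossingBoundProofs
import Literature.Probability.Percolation.RSW
import HarnessLib

/-!
# Schramm–Smirnov's discrete gluing theorem for critical bond percolation on `ℤ²`: preliminaries

Topic `Literature/Probability/Percolation`; proofs only (no definition, no named fact).  Preliminaries
for the proof of Theorem 1.1 ("Discrete gluing") of O. Schramm, S. Smirnov, *On the scaling limits of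
planar percolation*, Ann. Probab. 39 (2011), arXiv:1101.5820, for critical bond percolation on `δℤ²`
— the main statement `QuadCrossing.discreteGluing_of_fourArm_bound` is in the sequel
`QuadCrossingDiscreteGluing.lean`, its specialisation to Garban's named fact in
`QuadCrossingDiscreteGluingGarban.lean`:

* `exists_pos_le_dist_of_finite` (distinct points of a finite set are uniformly apart),
  `exists_collar` (a compact `α` whose points on a closed `C` lie in an open `G` stays in `G` within a
  collar of `C`), `ball_subset_or_disjoint_of_forall_le_dist` (a ball missing `∂S` lies inside or
  outside `S`), `IsFiniteLengthPathUnion.isCompact`, `dist_le_two_mul_of_mem_segment`;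
* the arithmetic of the scales (`arith_indices`, `arith_ratio`, `arith_square`, `arith_frac`) and the
  two summations of the proof (`far_sum_le`, `near_sum_le`), kept out of the main proof.

## References

* O. Schramm, S. Smirnov, Ann. Probab. 39 (2011) 1768–1814, arXiv:1101.5820, §2 (proof of
  Thm. 1.1). [SchrammSmirnov2011]
-/

noncomputable section

open Set Metric MeasureTheory Filter
open Literature.Probability.LatticeModels Literature.Topology.PlaneTopology

namespace Literature.Probability.Percolation

namespace QuadCrossing

/-! ### Finite point sets, collars, balls off the frontier -/

/-- A finite set of points of a metric space has a positive lower bound on the distances of its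
distinct points. [folklore] -/
theorem exists_pos_le_dist_of_finite {X : Type*} [MetricSpace X] {F : Set X} (hF : F.Finite) :
    ∃ m : ℝ, 0 < m ∧ ∀ x ∈ F, ∀ y ∈ F, x ≠ y → m ≤ dist x y := by
  classical
  set P : Finset (X × X) := (hF.toFinset ×ˢ hF.toFinset).filter (fun p => p.1 ≠ p.2) with hP
  by_cases hne : P.Nonempty
  · obtain ⟨p, hp, hmin⟩ := P.exists_min_image (fun p => dist p.1 p.2) hne
    have hp' := (Finset.mem_filter.1 hp).2
    refine ⟨dist p.1 p.2, dist_pos.2 hp', fun x hx y hy hxy => ?_⟩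
    exact hmin (x, y) (Finset.mem_filter.2 ⟨Finset.mem_product.2
      ⟨hF.mem_toFinset.2 hx, hF.mem_toFinset.2 hy⟩, hxy⟩)
  · refine ⟨1, one_pos, fun x hx y hy hxy => ?_⟩
    exact absurd ⟨(x, y), Finset.mem_filter.2 ⟨Finset.mem_product.2
      ⟨hF.mem_toFinset.2 hx, hF.mem_toFinset.2 hy⟩, hxy⟩⟩ hne

/-- **Collar**: if `α` is compact and its points on the closed set `C` are among the finitely many
`F ⊆ ⋃_{x ∈ F} B(x, r')`... precisely: if every point of `α ∩ C` lies in the open set `G`, then for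
some `t > 0` every point of `α` within `t` of `C` lies in `G`. [folklore] -/
theorem exists_collar {α C G : Set ℂ} (hα : IsCompact α) (hC : IsClosed C) (hG : IsOpen G)
    (hFG : α ∩ C ⊆ G) :
    ∃ t : ℝ, 0 < t ∧ ∀ w ∈ α, ∀ z ∈ C, dist w z < t → w ∈ G := by
  have hK : IsCompact (α \ G) := hα.diff hG
  have hdisj : Disjoint (α \ G) C := by
    rw [Set.disjoint_left]
    rintro w ⟨hwα, hwG⟩ hwC
    exact hwG (hFG ⟨hwα, hwC⟩)
  obtain ⟨t, ht, hdisj'⟩ := hdisj.exists_cthickenings hK hC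
  refine ⟨t, ht, fun w hw z hz hwz => ?_⟩
  by_contra hwG
  exact Set.disjoint_left.1 hdisj' (self_subset_cthickening _ ⟨hw, hwG⟩)
    (mem_cthickening_of_dist_le w z t C hz hwz.le)

/-- **A ball missing the frontier of a closed set lies inside or outside it.** [folklore] -/
theorem ball_subset_or_disjoint_of_forall_le_dist {S : Set ℂ} {w : ℂ} {t : ℝ}
    (ht : ∀ z ∈ frontier S, t ≤ dist w z) :
    (w ∈ S → ball w t ⊆ S) ∧ (w ∉ S → Disjoint (ball w t) S) := by
  have hcover : ball w t ⊆ interior S ∪ (closure S)ᶜ := by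
    intro y hy
    by_contra hcon
    simp only [mem_union, mem_compl_iff, not_or, not_not] at hcon
    have hyf : y ∈ frontier S := ⟨hcon.2, hcon.1⟩
    exact not_lt.2 (ht y hyf) (by rw [dist_comm]; exact mem_ball.1 hy)
  have hdisj : Disjoint (interior S) (closure S)ᶜ :=
    Set.disjoint_left.2 fun y hy hy' => hy' (interior_subset_closure hy)
  have hsub := (convex_ball w t).isPreconnected.subset_or_subset isOpen_interior
    isClosed_closure.isOpen_compl hdisj hcover
  by_cases ht0 : t ≤ 0
  · constructor
    · intro _ y hy; exact absurd (mem_ball.1 hy) (not_lt.2 (ht0.trans dist_nonneg))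
    · intro _; rw [Metric.ball_eq_empty.2 ht0]; exact Set.empty_disjoint _
  · push Not at ht0
    have hw : w ∈ ball w t := mem_ball_self ht0
    constructor
    · intro hwS
      rcases hsub with h | h
      · exact h.trans interior_subset
      · exact absurd (subset_closure hwS) (h hw)
    · intro hwS
      rcases hsub with h | h
      · exact absurd (interior_subset (h hw)) hwS
      · exact Set.disjoint_left.2 fun y hy hyS => h hy (subset_closure hyS)

end QuadCrossing


namespace QuadCrossing

/-! ### Compactness of cuts, drawn edges -/

/-- A cut is compact. [folklore] -/
theorem IsFiniteLengthPathUnion.isCompact {α : Set ℂ} (hα : IsFiniteLengthPathUnion α) :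
    IsCompact α := by
  obtain ⟨n, γ, rfl, -, -⟩ := hα
  exact isCompact_iUnion fun i => isCompact_range (γ i).continuous

/-- Points of a drawn lattice edge are within `2δ` of any of its points (`δ ≥ 0`). [folklore] -/
theorem dist_le_two_mul_of_mem_segment {δ : ℝ} (hδ : 0 ≤ δ) {x y : Site 2}
    (hxy : (zdGraph 2).Adj x y) {p q : ℂ} (hp : p ∈ segment ℝ (meshPoint δ x) (meshPoint δ y))
    (hq : q ∈ segment ℝ (meshPoint δ x) (meshPoint δ y)) : dist q p ≤ 2 * δ := by
  have h1 : ∀ z ∈ segment ℝ (meshPoint δ x) (meshPoint δ y), dist z (meshPoint δ x) ≤ δ := fun z hz => by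
    rw [dist_eq_norm]
    exact (norm_sub_le_of_mem_segment hz).trans
      ((norm_meshPoint_sub_meshPoint_le_of_adj δ hxy).trans (abs_of_nonneg hδ).le)
  linarith [dist_triangle q (meshPoint δ x) p, h1 q hq, h1 p hp, dist_comm p (meshPoint δ x)]


/-! ### Arithmetic of the scales -/

/-- The indices of the four-arm annulus are well ordered: `(ρ+δ)/δ + 5 ≤ (R-δ)/(√2 δ)` for
`ρ = 2s + 2δ`, `δ ≤ s ≤ R/20`. [folklore] -/
theorem arith_indices {s δ R : ℝ} (hδ : 0 < δ) (hδs : δ ≤ s) (hsR : s ≤ R / 20) :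
    (2 * s + 2 * δ + δ) / δ + 5 ≤ (R - δ) / (Real.sqrt 2 * δ) := by
  have hsqrt : Real.sqrt 2 ≤ 3 / 2 := by rw [Real.sqrt_le_left (by norm_num)]; norm_num
  have hsqrt0 : 0 < Real.sqrt 2 := by positivity
  have h1 : (2 * s + 2 * δ + δ) / δ + 5 = (2 * s + 8 * δ) / δ := by field_simp; ring
  rw [h1, div_le_div_iff₀ hδ (by positivity)]
  have h2 : (2 * s + 8 * δ) * (Real.sqrt 2 * δ) ≤ (10 * s) * ((3 / 2) * δ) :=
    mul_le_mul (by linarith) (mul_le_mul_of_nonneg_right hsqrt hδ.le) (by positivity) (by linarith)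
  have h3 : (10 * s) * ((3 / 2) * δ) = (15 * s) * δ := by ring
  have h4 : (15 * s) * δ ≤ (R - δ) * δ := mul_le_mul_of_nonneg_right (by linarith) hδ.le
  linarith

/-- Garban's ratio: `(m'+1)/(n'-1) ≤ 14√2 s / R`. [folklore] -/
theorem arith_ratio {s δ R : ℝ} {m' n' : ℕ} (hδ : 0 < δ) (hs : 0 < s) (hR : 0 < R) (hδs : δ ≤ s)
    (hδR : δ ≤ R / 8) (hm' : (m' : ℝ) < (2 * s + 2 * δ + δ) / δ + 1)
    (hn' : (R - δ) / (Real.sqrt 2 * δ) < n' + 1) (hn'1 : 1 ≤ n') :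
    ((m' + 1 : ℕ) : ℝ) / ((n' - 1 : ℕ) : ℝ) ≤ 14 * Real.sqrt 2 / R * s := by
  have hsqrt : Real.sqrt 2 ≤ 3 / 2 := by rw [Real.sqrt_le_left (by norm_num)]; norm_num
  have hsqrt1 : (1 : ℝ) ≤ Real.sqrt 2 := Real.one_le_sqrt.2 (by norm_num)
  have hsqrt0 : 0 < Real.sqrt 2 := by positivity
  -- numerator
  have hnum : ((m' + 1 : ℕ) : ℝ) ≤ 7 * s / δ := by
    push_cast
    have h1 : (2 * s + 2 * δ + δ) / δ + 1 + 1 = (2 * s + 5 * δ) / δ := by field_simp; ring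
    have h2 : (2 * s + 5 * δ) / δ ≤ 7 * s / δ := div_le_div_of_nonneg_right (by linarith) hδ.le
    linarith
  -- denominator
  have hden : R / (2 * Real.sqrt 2 * δ) ≤ ((n' - 1 : ℕ) : ℝ) := by
    rw [Nat.cast_sub hn'1, Nat.cast_one]
    have h1 : R / (2 * Real.sqrt 2 * δ) + 2 ≤ (R - δ) / (Real.sqrt 2 * δ) := by
      rw [div_add' _ _ _ (by positivity), div_le_div_iff₀ (by positivity) (by positivity)]
      -- `(R + 2 (2√2 δ)) (√2 δ) ≤ (R - δ) (2 √2 δ)`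
      have h2 : (R + 2 * (2 * Real.sqrt 2 * δ)) * (Real.sqrt 2 * δ) =
          (R + 4 * Real.sqrt 2 * δ) * (Real.sqrt 2 * δ) := by ring
      have h3 : (R - δ) * (2 * Real.sqrt 2 * δ) = (2 * R - 2 * δ) * (Real.sqrt 2 * δ) := by ring
      rw [h2, h3]
      refine mul_le_mul_of_nonneg_right ?_ (by positivity)
      have : 4 * Real.sqrt 2 * δ ≤ 6 * δ := by nlinarith
      linarith
    linarith
  have hden_pos : 0 < R / (2 * Real.sqrt 2 * δ) := by positivity
  calc ((m' + 1 : ℕ) : ℝ) / ((n' - 1 : ℕ) : ℝ) ≤ (7 * s / δ) / (R / (2 * Real.sqrt 2 * δ)) :=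
        div_le_div₀ (by positivity) hnum hden_pos hden
    _ = 14 * Real.sqrt 2 / R * s := by field_simp; ring

/-- The square of Garban's event fits in the collar: `√2 (n'+2) δ + δ < t`. [folklore] -/
theorem arith_square {δ R t : ℝ} {n' : ℕ} (hδ : 0 < δ) (hR : R = t / 4) (hδt : δ ≤ t / 32)
    (hnR : Real.sqrt 2 * (n' * δ) ≤ R - δ) :
    Real.sqrt 2 * ((n' + 2) * δ) + δ < t := by
  have hsqrt : Real.sqrt 2 ≤ 3 / 2 := by rw [Real.sqrt_le_left (by norm_num)]; norm_num
  have h1 : Real.sqrt 2 * ((n' + 2) * δ) + δ = Real.sqrt 2 * (n' * δ) + 2 * (Real.sqrt 2 * δ) + δ := by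
    ring
  have h2 : Real.sqrt 2 * δ ≤ 3 / 2 * δ := mul_le_mul_of_nonneg_right hsqrt hδ.le
  rw [h1]
  linarith

/-- The near annuli: `(r+δ)/(D'-δ) ≤ 4r/D'`. [folklore] -/
theorem arith_frac {r δ D' : ℝ} (hD' : 0 < D') (hδ0 : 0 ≤ δ) (hδr : δ ≤ r) (hδD : δ ≤ D' / 10) :
    (r + δ) / (D' - δ) ≤ 4 * r / D' := by
  have hr0 : 0 ≤ r := le_trans hδ0 hδr
  rw [div_le_div_iff₀ (by linarith) hD']
  have h5 : δ * D' ≤ r * D' := mul_le_mul_of_nonneg_right hδr hD'.le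
  have h6 : 4 * r * δ ≤ 4 * r * (D' / 10) := mul_le_mul_of_nonneg_left hδD (by linarith)
  have h7 : (r + δ) * D' = r * D' + δ * D' := by ring
  have h8 : 4 * r * (D' - δ) = 4 * (r * D') - 4 * r * δ := by ring
  rw [h7, h8]
  have h9 : 0 ≤ r * D' := mul_nonneg hr0 hD'.le
  linarith

/-- Summation of the four-arm bounds over the far balls: `#balls ≤ C(α)/s` terms of size
`c (C_R s)^{1+ε}` total at most `η/2` once `s ≤ κ^{1/ε}`, `κ = η / (2 (C(α) c C_R^{1+ε} + 1))`. [folklore] -/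
theorem far_sum_le {ι : Type*} (S : Finset ι) {a : ι → ℝ} {Cα cG CR εG s κ η : ℝ} (hs : 0 < s)
    (hcG : 0 < cG) (hCR : 0 < CR) (hCα : 0 ≤ Cα) (hεG : 0 < εG) (hκ : 0 < κ) (hη : 0 ≤ η)
    (hcard : (S.card : ℝ) ≤ Cα / s) (hsκ : s ≤ κ ^ (1 / εG))
    (hκdef : κ = η / (2 * (Cα * cG * CR ^ (1 + εG) + 1)))
    (hterm : ∀ j ∈ S, a j ≤ cG * (CR * s) ^ (1 + εG)) : ∑ j ∈ S, a j ≤ η / 2 := by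
  have hX0 : 0 ≤ Cα * cG * CR ^ (1 + εG) := by positivity
  calc ∑ j ∈ S, a j ≤ ∑ j ∈ S, cG * (CR * s) ^ (1 + εG) := Finset.sum_le_sum hterm
    _ = S.card * (cG * (CR * s) ^ (1 + εG)) := by rw [Finset.sum_const, nsmul_eq_mul]
    _ ≤ Cα / s * (cG * (CR * s) ^ (1 + εG)) := mul_le_mul_of_nonneg_right hcard (by positivity)
    _ = Cα * cG * CR ^ (1 + εG) * s ^ εG := by
        rw [Real.mul_rpow hCR.le hs.le, Real.rpow_add hs, Real.rpow_one]
        field_simp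
    _ ≤ Cα * cG * CR ^ (1 + εG) * κ := by
        apply mul_le_mul_of_nonneg_left _ hX0
        calc s ^ εG ≤ (κ ^ (1 / εG)) ^ εG := Real.rpow_le_rpow hs.le hsκ hεG.le
          _ = κ := by rw [← Real.rpow_mul hκ.le, one_div_mul_cancel hεG.ne', Real.rpow_one]
    _ ≤ η / 2 := by
        set X : ℝ := Cα * cG * CR ^ (1 + εG) with hX
        have h1 : X * κ = η / 2 * (X / (X + 1)) := by rw [hκdef]; field_simp
        rw [h1]
        have h2 : X / (X + 1) ≤ 1 := (div_le_one (by positivity)).2 (by linarith)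
        calc η / 2 * (X / (X + 1)) ≤ η / 2 * 1 := mul_le_mul_of_nonneg_left h2 (by positivity)
          _ = η / 2 := mul_one _

/-- Summation of the one-arm bounds over the boundary points. [folklore] -/
theorem near_sum_le {ι : Type*} (S : Finset ι) {b : ι → ℝ} {q B₀ η : ℝ} (hterm : ∀ x ∈ S, b x ≤ q)
    (hq : q ≤ B₀) (hkey : (S.card : ℝ) * B₀ ≤ η / 2) : ∑ x ∈ S, b x ≤ η / 2 := by
  calc ∑ x ∈ S, b x ≤ ∑ x ∈ S, B₀ := Finset.sum_le_sum fun x hx => (hterm x hx).trans hq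
    _ = S.card * B₀ := by rw [Finset.sum_const, nsmul_eq_mul]
    _ ≤ η / 2 := hkey


end QuadCrossing

end Literature.Probability.Percolation

end
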